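import Summits.QuantumFields.YangMills.Theses.LangevinControlUV
import Summits.QuantumFields.YangMills.Theorems.HypercubicLimit.Negative.AllTimesGapFalse
import Literature.MathematicalPhysics.QuantumFieldTheory.LatticeGaugeProofs

/-!
# Line `knabe-block-sampler` — skeleton for crux `LatticeGapInUVUnits` (stmt-QuantumFields-9366)

Crux (route `LangevinControlUV`, rev 7, item 9366, rank 5 — the IMPORTED infrared leg):
`Summit.QuantumFields.YangMills.Theses.LangevinControlUV.LatticeGapInUVUnits`, literally
`∀ G (compact simple) r a, Package r a → Concl r a` (§0 `crux_iff`): every unit map `a` carrying the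
femto two-point package clusters ALL pairs of gauge-invariant local observables, volume-uniformly, at
rate `c₁ · a(β)` per lattice step on all tori `(2S+1)⁴`, `S ≥ S₁(β)`, `n ≤ S`.

Idea card `Cruxes/LatticeGapInUVUnits/Ideas/knabe-block-sampler.md` (ideator 1), MERGED by the r1
triage panel with its twin `heatbath-knabe-threshold` (ideator 3): survivor design = ideator 3's
OVERLAPPING block geometry and worst-exterior reading + ideator 1's Lean typing (complex/real Hilbert
space device, `condExp`/link-σ-algebra certificate, light-cone adapter). Panel verdicts acted on:
TRIAGE-r1-1 pass (device true, `t n = 216/(2n−1)` for range 1; "typical exterior" void; prefer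
overlaps); TRIAGE-r1-2 fail-as-typed (PARTITION certificate dies in its own Gaussian calibration,
patch gap `≍ a(β)/K`; typing hole `L = m·b` only); TRIAGE-r1-3 fail-as-typed (closed form
`γ = c·coth c / b` for partitions; use offset-2-commuting overlapping blocks; widen to all odd sides).

THE LINE. Block heat bath of Wilson's measure on the torus `(ℤ/N)⁴` with OVERLAPPING blocks: nominal
cell `b = ⌈K/a(β)⌉` lattice units, `m = N/b` uneven cells per axis (lengths in `[b, 2b]`, §1
`cellOf` — every side `N`, odd or not, is covered), blocks `B_z` = the `2⁴`-clusters of cells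
`{z, z+1}⁴` (overlap = one cell ≍ block: the generous-overlap Schwarz regime of TRIAGE-r1-2 T2 /
r1-3 T1(b), not the partition that dies by interface ping-pong), `Q_z = 1 − E[· | links outside B_z]`.
Blocks whose indices differ by `≥ 3` in some axis are at lattice distance `≥ 2`, share no plaquette
and their `Q`'s commute (non-commuting radius `R = 2`, `5⁴ − 1 = 624` neighbours). Stubs:

* S0 `stub_rulerReduction : RulerReduction` — THE TYPED-`∀a` SOCKET (see "Disproof used"): every
  unit map with the package is eventually dominated, up to a constant, by a CONTINUOUS unit map with
  the package. It is `id` on continuous rulers (`rulerReduction_of_continuous`, proved) and is the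
  unique place where the crux's known misstatement lives; under the refuter's repair C′ it drops out
  (`cruxRepaired_of_stubs`, proved from S1–S4 alone).
* S1 `stub_knabeAmplification : KnabeAmplification` — the device: Knabe–Gosset–Mozgunov–Lemm
  local-gap amplification for projections on a real Hilbert space indexed by `(ℤ/M)⁴`, commuting
  beyond sup-distance `2`, threshold `t n → 0` (count: `t n = 3000/(2n−1)`, `c = 1`). Provable now.
* S2 `stub_blockSamplerCertificate : BlockSamplerCertificate` — HARDEST, the honest residue: for
  continuous rulers with the package, ONE `β`-uniform local Poincaré inequality for the overlapping
  block sampler on `n₀`-patches of cells of size `⌈K/a(β)⌉` (gauge-invariant test functions,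
  integrated = worst-exterior form), with constant `γ` independent of `n₀` and `β`, on every torus
  `N ≥ (4n₀+8)·b`. The mass gap at one physical scale in spectral clothing.
* S3 `stub_samplerTranscription : SamplerTranscription` — the block sampler of Wilson's measure IS a
  Knabe system on `L²(μ)^𝒢`: `Q_z` are orthogonal projections preserving gauge-invariant functions,
  commute at index distance `≥ 3` (Markov property of the plaquette interaction), the variance-form
  local inequality is `γ A_P ≤ A_P²`, and `ker ∑ Q_z` = constants; so `LocalPoincare γ` gives
  `GlobalPoincare (c (γ − t n₀))`. Provable now (functional analysis + DLR on the torus).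
* S4 `stub_gapToClustering : GapToClustering` — a global block-sampler Poincaré constant `γ'` on the
  torus `(2S+1)⁴` with cell `b` gives `|corr(A, B, n)| ≤ C(A,B) e^{−ρ(γ') n/b}`: semigroup
  `e^{−tH}` (bounded generator), EXACT pull-out `μ(fg) = μ(P_t^{Λ_f} f · P_t^{Λ_g} g)` for commuting
  partial semigroups, Dyson-series light cone `‖P_t f − P_t^{Λ_f} f‖ ≤ (624 e t / D)^D ‖f‖_∞`, and
  spectral decay `‖P_t f̄‖ ≤ e^{−γ' t}‖f̄‖`; all constants combinatorial (`β`-free). Provable now.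

Composition (`stubsImplyCrux`, sorry-free): `n₀` from `t → 0` (`t n₀ < γ/2`), `b ≤ 2K/a(β)` from
`a → 0` (Disproof §4: `Tendsto a` is used exactly here), `c₁ = ρ/(2K)`, `S₁ β = (4n₀+8)⌈K/a β⌉`,
`C = max C(A,B) 0`; then S0 + `concl_of_dominated`. `LatticeGapInUVUnits_of` concludes the crux BY NAME.

Disproof used (`Cruxes/LatticeGapInUVUnits/Disproof.lean` v5, cdisprove gen 1; no `_false_without_`
theorem, no formal kill; paper verdict MISSTATED via slow step rulers, C′ = `Continuous a`):
§0 `crux_iff` (copied verbatim as this file's §0 so the composition is definitional); docblock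
PAPER KILL + PROVER NOTE — honoured structurally: S2–S4 are stated for the REPAIRED reading and
`cruxRepaired_of_stubs` proves Disproof's `CruxRepaired` verbatim from S1–S4, while S0 isolates the
typed-`∀a` residue (physically false for slow step rulers exactly as the crux is; the tenure repair
"restrict 9363/9366 to continuous unit maps" makes S0 moot); §1 `concl_of_eventually_le` + §2
`concl_smul_iff` = this file's `concl_of_dominated` (the line uses H = domination by a continuous
ruler at S0); §4 `Tendsto a` load-bearing — used in `concl_of_localPoincare` (`a β ≤ K` eventually);
§6 `packageWith_shape_tendsto_zero` — consistent and unused (`Γ` never enters; the ruler enters only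
through `⌈K/a β⌉`); §7 `not_conclUniformC_of_simple` / landed
`Negative.not_uniform_constant_clustering_of_simple` (Theorems/LatticeGapInUVUnits/Negative/
UniformConstantFalse.lean) — respected: S4 and `Concl` carry PER-PAIR constants `∀ A B, ∃ C`, never the
refuted `∃ C, ∀ A B`; landed `Negative.WeakCouplingConcentration` (§3/§6 of the Disproof) — the junk
subsingleton group cannot meet the package (re-derived in §4 below, `not_package_of_subsingleton`), so
no stub is exercised there, and `Γ(a(β)) → 0` is consistent with a line that never reads `Γ`. (The two
Negative modules are cited by name rather than imported: at publish time the farm reported them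
`remote:stale:unbuilt`; the folder keeps `line-knabe-block-sampler.with-negatives.lean`, identical but
importing both and instantiating `not_uniform_constant_clustering_of_simple` /
`not_femto_lower_bound_of_subsingleton` as `example`s, for re-check once they are built.)
-/

open scoped BigOperators InnerProductSpace
open MeasureTheory Filter Topology
open Literature.MathematicalPhysics.QuantumFieldTheory Literature.MathematicalPhysics.QuantumLattice
open Summit.QuantumFields.YangMills.Theses.LangevinControlUV

noncomputable section

namespace Summit.QuantumFields.YangMills.Cruxes.LatticeGapInUVUnits.KnabeBlockSampler

/-! ## §0 Anatomy of the crux (verbatim `Cruxes/LatticeGapInUVUnits/Disproof.lean` §0) -/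

section Anatomy

variable {G : Type} [Group G] [TopologicalSpace G] [IsTopologicalGroup G] [CompactSpace G]
  [MeasurableSpace G] [BorelSpace G]

/-- The femto two-point bounds in ONE periodic box `(ℤ/L)⁴` at coupling `β` (verbatim the `let`-body
of the crux's hypothesis). -/
def BoxBounds (r : LatticeRep G) (a Γ : ℝ → ℝ) (c C : ℝ) (L : ℕ) [NeZero L] (β : ℝ) : Prop :=
  let P : (Fin 4 → ZMod L) → Fin 4 → Fin 4 → GaugeConfig 4 L G → ℝ :=
    fun x i j U => (r.N : ℝ) - (r.ρ (plaquetteHolonomy U x i j)).trace.re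
  let E : (GaugeConfig 4 L G → ℝ) → ℝ := fun F => wilsonExpectation (d := 4) (L := L) r.ρ β F
  let cov : (GaugeConfig 4 L G → ℝ) → (GaugeConfig 4 L G → ℝ) → ℝ :=
    fun F F' => E (fun U => F U * F' U) - E F * E F'
  let dist : (Fin 4 → ZMod L) → (Fin 4 → ZMod L) → ℝ :=
    fun x y => Real.sqrt (∑ k : Fin 4, (((x k - y k).valMinAbs : ℤ) : ℝ) ^ 2)
  (∀ n : ℕ, 1 ≤ n → 8 * n ≤ L →
      c * Γ ((n : ℝ) * a β) ≤ (n : ℝ) ^ 8 * cov (P 0 0 1) (P (Pi.single (2 : Fin 4) ((n : ℕ) : ZMod L)) 0 1) ∧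
        (n : ℝ) ^ 8 * cov (P 0 0 1) (P (Pi.single (2 : Fin 4) ((n : ℕ) : ZMod L)) 0 1) ≤ C * Γ ((n : ℝ) * a β)) ∧
    (∀ (x y : Fin 4 → ZMod L) (i j i' j' : Fin 4), x ≠ y → i ≠ j → i' ≠ j' →
      |cov (P x i j) (P y i' j')| * dist x y ^ 8 ≤ C * Γ (dist x y * a β))

/-- The femto two-point PACKAGE of the unit map `a` (hypothesis of the crux). -/
def Package (r : LatticeRep G) (a : ℝ → ℝ) : Prop :=
  ∃ (Γ : ℝ → ℝ) (β₀ ℓ₀ c C : ℝ), 0 < ℓ₀ ∧ 0 < c ∧ (∀ β, 0 < a β) ∧ Tendsto a atTop (𝓝 0) ∧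
    (∀ s : ℝ, 0 < s → s ≤ ℓ₀ → 0 < Γ s ∧ Γ s ≤ 1) ∧
      ∀ (L : ℕ) [NeZero L] (β : ℝ), β₀ ≤ β → (L : ℝ) * a β ≤ ℓ₀ → BoxBounds r a Γ c C L β

/-- The conclusion of the crux: volume-uniform exponential clustering of all pairs of gauge-invariant
local observables at SOME rate `c₁ · a(β)` per lattice step (per-pair constants `C`). -/
def Concl (r : LatticeRep G) (a : ℝ → ℝ) : Prop :=
  ∃ (c₁ β₂ : ℝ) (S₁ : ℝ → ℕ), 0 < c₁ ∧ ∀ A B : YMSpecies G, ∃ C : ℝ, ∀ β : ℝ, β₂ ≤ β → ∀ S n : ℕ,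
    S₁ β ≤ S → n ≤ S → |latticeConnectedCorr r.ρ β (2 * S + 1) A.F B.F n| ≤ C * Real.exp (-(c₁ * a β * n))

end Anatomy

/-- **The crux uncurried** (definitional): `LatticeGapInUVUnits ↔ ∀ G r a, Package r a → Concl r a`. -/
theorem crux_iff :
    LatticeGapInUVUnits ↔
      ∀ (G : Type) [Group G] [TopologicalSpace G] [IsTopologicalGroup G] [CompactSpace G],
        IsCompactSimpleLieGroup G →
          letI : MeasurableSpace G := borel G
          haveI : BorelSpace G := ⟨rfl⟩
          ∀ (r : LatticeRep G) (a : ℝ → ℝ), Package r a → Concl r a := by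
  constructor
  · intro h G _ _ _ _ hG r a hP
    obtain ⟨Γ, β₀, ℓ₀, c, C, hℓ, hc, hpos, hlim, hΓ, hbox⟩ := hP
    exact h G hG r a ⟨Γ, β₀, ℓ₀, c, C, hℓ, hc, hpos, hlim, hΓ, fun L _ β h₁ h₂ => hbox L β h₁ h₂⟩
  · intro h G _ _ _ _ hG r a hP
    obtain ⟨Γ, β₀, ℓ₀, c, C, hℓ, hc, hpos, hlim, hΓ, hbox⟩ := hP
    exact h G hG r a ⟨Γ, β₀, ℓ₀, c, C, hℓ, hc, hpos, hlim, hΓ, fun L _ β h₁ h₂ => hbox L β h₁ h₂⟩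

/-! ## §1 Vocabulary: the abstract device, uneven cells, overlapping blocks, link σ-algebras, the two
Poincaré inequalities of the block sampler -/

/-- Cyclic distance of two indices of `Fin M`, read in `ℤ/M`. -/
def cdist {M : ℕ} (i j : Fin M) : ℕ :=
  ((((i : ℕ) : ZMod M) - ((j : ℕ) : ZMod M)).valMinAbs).natAbs

section Device

variable {E : Type} [NormedAddCommGroup E] [InnerProductSpace ℝ E] [CompleteSpace E] {M : ℕ}

/-- The `n`-patch operator at `x`: `A_x = ∑_{y : sup-cdist(y, x) < n} Q y` (a cube of side `2n − 1`
blocks around `x` on the index torus `(ℤ/M)⁴`). -/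
def patchOp (Q : (Fin 4 → Fin M) → (E →L[ℝ] E)) (n : ℕ) (x : Fin 4 → Fin M) : E →L[ℝ] E :=
  ∑ y : Fin 4 → Fin M, if (∀ k, cdist (y k) (x k) < n) then Q y else 0

/-- The total operator `H = ∑ₓ Q x` (the block heat-bath generator in the application). -/
def totalOp (Q : (Fin 4 → Fin M) → (E →L[ℝ] E)) : E →L[ℝ] E :=
  ∑ x : Fin 4 → Fin M, Q x

end Device

/-- **Knabe-type amplification with explicit threshold `t` and constant `c`, non-commuting radius `R`**
(abstract device; Knabe 1988, Gosset–Mozgunov 2016, Lemm–Mozgunov 2019, Lemm 2019 — stated for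
orthogonal projections on a REAL Hilbert space indexed by the 4-torus `(ℤ/M)⁴`, commuting as soon as
the indices differ by more than `R` in some axis, in the Loewner order of Mathlib): if every `n`-patch
operator satisfies `γ A_x ≤ A_x²` ("gap `≥ γ` above its kernel") then `c (γ − t n) H ≤ H²`. The
argument (TRIAGE-r1-1 §C, r1-2 (c)) uses only `Q² = Q = Q*`, commutation at distance, pair counting
and `−(PQ + QP) ≤ P + Q`; for `R = 2`: `t n = 3000/(2n−1)`, `c = 1`. -/
def KnabeWith (R : ℕ) (t : ℕ → ℝ) (c : ℝ) : Prop :=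
  ∀ (M : ℕ) (E : Type) [NormedAddCommGroup E] [InnerProductSpace ℝ E] [CompleteSpace E]
    (Q : (Fin 4 → Fin M) → (E →L[ℝ] E)),
    (∀ x, IsSelfAdjoint (Q x) ∧ Q x * Q x = Q x) →
    (∀ x y, (∃ k, R < cdist (x k) (y k)) → Q x * Q y = Q y * Q x) →
    ∀ (n : ℕ) (γ : ℝ), 1 ≤ n → 4 * (n + R) ≤ M → 0 ≤ γ →
      (∀ x : Fin 4 → Fin M, γ • patchOp Q n x ≤ patchOp Q n x * patchOp Q n x) →
      (c * (γ - t n)) • totalOp Q ≤ totalOp Q * totalOp Q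

section Blocks

variable {G : Type} [MeasurableSpace G] {N : ℕ}

/-- The cell of a torus coordinate: `⌊x·m/N⌋ ∈ ℤ/m` — the `m` uneven cells
`[⌈jN/m⌉, ⌈(j+1)N/m⌉)` of `ℤ/N` have lengths in `{⌊N/m⌋, ⌈N/m⌉} ⊂ [b, 2b]` when `m = N/b`, `N ≥ 2b`
(every torus side, odd sides `2S+1` included — the `[b, 2b]`-frames of TRIAGE-r1-2 (b) / r1-3). -/
def cellOf (N m : ℕ) (x : ZMod N) : ZMod m :=
  ((x.val * m / N : ℕ) : ZMod m)

/-- Site `x` lies in the OVERLAPPING block `B_z`, the `2⁴`-cluster of cells `{z_k, z_k + 1}` in every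
axis (block side ∈ `[2b, 4b]`, neighbouring blocks overlap in a full cell `≥ b`). -/
def InBlock (N m : ℕ) (z : Fin 4 → Fin m) (x : Site 4 N) : Prop :=
  ∀ k, (cellOf N m (x k) - ((z k : ℕ) : ZMod m)).val ≤ 1

/-- Block `z` lies in the `n₀`-patch centred at `ζ` (sup-cyclic index distance `< n₀`). -/
def InPatch {m : ℕ} (n₀ : ℕ) (ζ z : Fin 4 → Fin m) : Prop :=
  ∀ k, cdist (z k) (ζ k) < n₀

instance {m : ℕ} (n₀ : ℕ) (ζ z : Fin 4 → Fin m) : Decidable (InPatch n₀ ζ z) := by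
  unfold InPatch; infer_instance

/-- σ-algebra generated by the link variables in a set `S` of edges of the torus of side `N`. -/
@[reducible] def linkSigma (S : Set (Edge 4 N)) : MeasurableSpace (GaugeConfig 4 N G) :=
  MeasurableSpace.comap (fun (U : GaugeConfig 4 N G) (e : S) => U e.1) MeasurableSpace.pi

variable (G) in
/-- The EXTERIOR σ-algebra of block `z`: links (based) outside `B_z`. `1 − E[· | extSigma z]` is the
heat-bath projection `Q_z` of the block. -/
@[reducible] def extSigma (N m : ℕ) (z : Fin 4 → Fin m) : MeasurableSpace (GaugeConfig 4 N G) :=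
  linkSigma {e | ¬ InBlock N m z e.1}

variable (G) in
/-- The exterior σ-algebra of the `n₀`-patch centred at `ζ`: links outside every block of the patch. -/
@[reducible] def patchExtSigma (N m n₀ : ℕ) (ζ : Fin 4 → Fin m) : MeasurableSpace (GaugeConfig 4 N G) :=
  linkSigma {e | ∀ z : Fin 4 → Fin m, InPatch n₀ ζ z → ¬ InBlock N m z e.1}

end Blocks

section Sampler

variable {G : Type} [Group G] [TopologicalSpace G] [IsTopologicalGroup G] [CompactSpace G]
  [MeasurableSpace G] [BorelSpace G]

/-- **Local Poincaré inequality of the overlapping block sampler** on the torus `(ℤ/N)⁴` at coupling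
`β`, nominal cell `b` (`m = N/b` cells per axis), patch size `n₀`, constant `γ`: for every patch centre
`ζ` and every bounded measurable GAUGE-INVARIANT `F`,
`∫ (F − μ[F | patch exterior])² dμ ≤ γ⁻¹ ∑_{z ∈ patch} ∫ (F − μ[F | exterior of B_z])² dμ`
— in operator language `γ A_P ≤ A_P²` on `L²(μ)^𝒢` for the patch operator `A_P = ∑_{z ∈ P} Q_z`. The
integrated form fibres over the μ-law of the exterior; by upper semicontinuity of the fibrewise
constant and full support of Wilson's measure it is the WORST-exterior inequality (TRIAGE-r1-1 (a),
r1-2 (a)): the same exposure to boundary conditions as a Dobrushin–Shlosman condition, in `L²`. -/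
def LocalPoincare (r : LatticeRep G) (β : ℝ) (N b n₀ : ℕ) [NeZero N] (γ : ℝ) : Prop :=
  ∀ (ζ : Fin 4 → Fin (N / b)) (F : GaugeConfig 4 N G → ℝ), Measurable F → (∃ B : ℝ, ∀ U, |F U| ≤ B) →
    IsGaugeInvariant F →
      ∫ U, (F U - ((wilsonMeasure (d := 4) (L := N) r.ρ β)[F|patchExtSigma G N (N / b) n₀ ζ]) U) ^ 2
          ∂(wilsonMeasure (d := 4) (L := N) r.ρ β) ≤
        γ⁻¹ * ∑ z : Fin 4 → Fin (N / b), if InPatch n₀ ζ z then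
          ∫ U, (F U - ((wilsonMeasure (d := 4) (L := N) r.ρ β)[F|extSigma G N (N / b) z]) U) ^ 2
            ∂(wilsonMeasure (d := 4) (L := N) r.ρ β) else 0

/-- **Global Poincaré inequality of the overlapping block sampler** (spectral gap `≥ γ` of
`H = ∑_z Q_z` on `L²(μ)^𝒢`): `Var_μ(F) ≤ γ⁻¹ ∑_z ∫ (F − μ[F | exterior of B_z])² dμ` for every bounded
measurable gauge-invariant `F` on the torus `(ℤ/N)⁴`, cells `m = N/b`. -/
def GlobalPoincare (r : LatticeRep G) (β : ℝ) (N b : ℕ) [NeZero N] (γ : ℝ) : Prop :=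
  ∀ (F : GaugeConfig 4 N G → ℝ), Measurable F → (∃ B : ℝ, ∀ U, |F U| ≤ B) → IsGaugeInvariant F →
    ∫ U, (F U - ∫ V, F V ∂(wilsonMeasure (d := 4) (L := N) r.ρ β)) ^ 2
        ∂(wilsonMeasure (d := 4) (L := N) r.ρ β) ≤
      γ⁻¹ * ∑ z : Fin 4 → Fin (N / b),
        ∫ U, (F U - ((wilsonMeasure (d := 4) (L := N) r.ρ β)[F|extSigma G N (N / b) z]) U) ^ 2
          ∂(wilsonMeasure (d := 4) (L := N) r.ρ β)

end Sampler

/-! ## §2 The five stub statements -/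

/-- **Stub S0 statement — ruler reduction (the typed-`∀a` socket).** Every unit map carrying the femto
package is eventually dominated, up to a constant `K₀`, by a CONTINUOUS unit map carrying the package.
Trivial on continuous rulers (`rulerReduction_of_continuous`); for the slow STEP rulers of the
Disproof's PAPER KILL it is (physically) false exactly as the crux is — this stub is where the typed
crux's misstatement is parked, not a work item: it becomes moot when 9366 is restated as C′. -/
def RulerReduction : Prop :=
  ∀ (G : Type) [Group G] [TopologicalSpace G] [IsTopologicalGroup G] [CompactSpace G],
    IsCompactSimpleLieGroup G →
      letI : MeasurableSpace G := borel G
      haveI : BorelSpace G := ⟨rfl⟩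
      ∀ (r : LatticeRep G) (a : ℝ → ℝ), Package r a →
        ∃ (a' : ℝ → ℝ) (K₀ : ℝ), Continuous a' ∧ Package r a' ∧ 0 < K₀ ∧ ∀ᶠ β in atTop, a β ≤ K₀ * a' β

/-- **Stub S1 statement — Knabe amplification** (the device, radius `2`): some threshold `t n → 0` and
`c > 0` work. Pure operator algebra, provable now. -/
def KnabeAmplification : Prop :=
  ∃ (t : ℕ → ℝ) (c : ℝ), 0 < c ∧ Tendsto t atTop (𝓝 0) ∧ KnabeWith 2 t c

/-- **Stub S2 statement — the block-sampler certificate (HARDEST; the honest residue).** For every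
compact simple `G`, faithful `r` and CONTINUOUS unit map `a` with the femto package there are a
physical cell size `K` and ONE constant `γ > 0` such that for every patch size `n₀`, for all large `β`
and every torus of side `N ≥ (4n₀+8)·⌈K/a β⌉`, the overlapping block sampler with nominal cell
`⌈K/a β⌉` satisfies the local Poincaré inequality with constant `γ` on gauge-invariant functions —
uniformly in `β` AND in `n₀` (massive at the block scale ⇒ generous-overlap one-level Schwarz constant
independent of the number of subdomains; a massless/Coulomb field gives `≍ n₀⁻²` and fails, as it must
for `U(1)₄` and `SU(2)₅`). -/
def BlockSamplerCertificate : Prop :=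
  ∀ (G : Type) [Group G] [TopologicalSpace G] [IsTopologicalGroup G] [CompactSpace G],
    IsCompactSimpleLieGroup G →
      letI : MeasurableSpace G := borel G
      haveI : BorelSpace G := ⟨rfl⟩
      ∀ (r : LatticeRep G) (a : ℝ → ℝ), Continuous a → Package r a →
        ∃ (K γ : ℝ), 0 < K ∧ 0 < γ ∧ ∀ n₀ : ℕ, 1 ≤ n₀ → ∃ β₂ : ℝ, ∀ β : ℝ, β₂ ≤ β →
          ∀ (N : ℕ) [NeZero N], (4 * n₀ + 8) * ⌈K / a β⌉₊ ≤ N → LocalPoincare r β N ⌈K / a β⌉₊ n₀ γ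

/-- **Stub S3 statement — transcription of the sampler into Knabe's algebra.** Whenever the abstract
device holds with `(t, c)`, `c > 0`, the local Poincaré inequality with `γ > t n₀` on every `n₀`-patch of
a torus with `m = N/b ≥ 4n₀ + 8` cells per axis gives the global one with constant `c (γ − t n₀)`:
`Q_z = 1 − E[·|extSigma z]` are orthogonal projections of `L²(μ)` preserving the gauge-invariant
subspace (gauge transformations preserve `μ` and the link σ-algebras), `Q_z Q_w = Q_w Q_z` when
`cdist ≥ 3` in some axis (blocks at lattice distance `≥ 2`: Markov property of the plaquette
interaction), `LocalPoincare ⇒ γ A_P ≤ A_P²` (the inequality itself identifies `ker A_P`), and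
`ker H` = constants (a function measurable outside every block is a.e. constant: product structure of
Haar, equivalence of `μ` with it). Provable now. -/
def SamplerTranscription : Prop :=
  ∀ (t : ℕ → ℝ) (c : ℝ), KnabeWith 2 t c → 0 < c →
    ∀ (G : Type) [Group G] [TopologicalSpace G] [IsTopologicalGroup G] [CompactSpace G]
      [MeasurableSpace G] [BorelSpace G] (r : LatticeRep G) (β : ℝ) (N b n₀ : ℕ) [NeZero N] (γ : ℝ),
      1 ≤ n₀ → 1 ≤ b → (4 * n₀ + 8) * b ≤ N → 0 < γ → t n₀ < γ →
        LocalPoincare r β N b n₀ γ → GlobalPoincare r β N b (c * (γ - t n₀))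

/-- **Stub S4 statement — gap ⇒ clustering for the block sampler, in the crux's currency.** For every
global constant `γ > 0` there is a rate `ρ = ρ(γ) > 0` (combinatorial) such that for every pair of
gauge-invariant local observables there is `C = C(A, B)` (NOT uniform in the pair — Disproof §7) with:
on every torus `(2S+1)⁴` and nominal cell `b ≥ 1`, `GlobalPoincare γ` implies
`|corr_β(A, B, n)| ≤ C e^{−ρ n / b}` for `n ≤ S`. Proof route: `H = ∑ Q_z` is bounded, `P_t = e^{−tH}`
fixes `μ` and contracts mean-zero invariant functions by `e^{−γt}`; partial semigroups over disjoint
non-adjacent block families commute and pull out exterior-measurable factors EXACTLY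
(`μ(fg) = μ(P_t^{Λ_f}f · P_t^{Λ_g}g)`), and the Dyson series gives the light cone
`‖P_t f − P_t^{Λ_f} f‖ ≤ (624·e·t/D)^D ‖f‖_∞` at block distance `D ≍ n/(4b)`; take `t = D/(2·624·e)`.
Small tori / short separations are absorbed in `C(A,B)` (`|corr| ≤ 2 C_A C_B`). Provable now. -/
def GapToClustering : Prop :=
  ∀ (G : Type) [Group G] [TopologicalSpace G] [IsTopologicalGroup G] [CompactSpace G]
    [MeasurableSpace G] [BorelSpace G] (r : LatticeRep G) (γ : ℝ), 0 < γ →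
      ∃ ρ : ℝ, 0 < ρ ∧ ∀ A B : YMSpecies G, ∃ C : ℝ, ∀ (β : ℝ) (b S n : ℕ), 1 ≤ b → n ≤ S →
        GlobalPoincare r β (2 * S + 1) b γ →
          |latticeConnectedCorr r.ρ β (2 * S + 1) A.F B.F n| ≤ C * Real.exp (-(ρ * n / b))

/-! ## §3 Registered stubs and the checked composition -/

/-- Stub S0 (typed-`∀a` socket; NOT a work item — see the docstring of `RulerReduction`). -/
theorem stub_rulerReduction : RulerReduction := by
  sorry

/-- Stub S1 (M/L; provable now: Knabe's squaring argument with radius-2 pair counting). -/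
theorem stub_knabeAmplification : KnabeAmplification := by
  sorry

/-- Stub S2 (open, HARDEST: the one-scale worst-exterior block-sampler gap, β- and n₀-uniform). -/
theorem stub_blockSamplerCertificate : BlockSamplerCertificate := by
  sorry

/-- Stub S3 (L; provable now: condExp projections on `L²(μ)^𝒢`, Markov commutation, kernels). -/
theorem stub_samplerTranscription : SamplerTranscription := by
  sorry

/-- Stub S4 (L/XL; provable now: bounded-generator semigroup, exact pull-out, Dyson light cone). -/
theorem stub_gapToClustering : GapToClustering := by
  sorry

section Composition

variable {G : Type} [Group G] [TopologicalSpace G] [IsTopologicalGroup G] [CompactSpace G]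
  [MeasurableSpace G] [BorelSpace G]

/-- S0 is the identity on continuous rulers (so under the repair C′ it carries no content). -/
theorem rulerReduction_of_continuous (r : LatticeRep G) {a : ℝ → ℝ} (ha : Continuous a)
    (hP : Package r a) :
    ∃ (a' : ℝ → ℝ) (K₀ : ℝ), Continuous a' ∧ Package r a' ∧ 0 < K₀ ∧ ∀ᶠ β in atTop, a β ≤ K₀ * a' β :=
  ⟨a, 1, ha, hP, one_pos, Eventually.of_forall fun β => by simp⟩

/-- **Domination transfer** (Disproof §1 `concl_of_eventually_le` and §2 `concl_smul_iff` in one step):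
clustering in the units of `a'` and `a ≤ K₀ a'` eventually give clustering in the units of `a`, with rate
constant `c₁/K₀`. -/
theorem concl_of_dominated (r : LatticeRep G) {a a' : ℝ → ℝ} (h : Concl r a') {K₀ : ℝ} (hK : 0 < K₀)
    (hdom : ∀ᶠ β in atTop, a β ≤ K₀ * a' β) : Concl r a := by
  obtain ⟨c₁, β₂, S₁, hc, h⟩ := h
  obtain ⟨βs, hβs⟩ := eventually_atTop.1 hdom
  refine ⟨c₁ / K₀, max β₂ βs, S₁, div_pos hc hK, fun A B => ?_⟩
  obtain ⟨C, hC⟩ := h A B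
  refine ⟨max C 0, fun β hβ S n hS hn => ?_⟩
  have hβ₂ : β₂ ≤ β := (le_max_left _ _).trans hβ
  have hle : a β ≤ K₀ * a' β := hβs β ((le_max_right _ _).trans hβ)
  refine (hC β hβ₂ S n hS hn).trans ?_
  have hn0 : (0 : ℝ) ≤ n := Nat.cast_nonneg n
  have key : c₁ / K₀ * a β * n ≤ c₁ * a' β * n := by
    refine mul_le_mul_of_nonneg_right ?_ hn0
    calc c₁ / K₀ * a β ≤ c₁ / K₀ * (K₀ * a' β) := mul_le_mul_of_nonneg_left hle (div_pos hc hK).le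
      _ = c₁ / K₀ * K₀ * a' β := by ring
      _ = c₁ * a' β := by rw [div_mul_cancel₀ c₁ hK.ne']
  calc C * Real.exp (-(c₁ * a' β * n)) ≤ max C 0 * Real.exp (-(c₁ * a' β * n)) :=
        mul_le_mul_of_nonneg_right (le_max_left _ _) (Real.exp_pos _).le
    _ ≤ max C 0 * Real.exp (-(c₁ / K₀ * a β * n)) :=
        mul_le_mul_of_nonneg_left (Real.exp_le_exp.2 (neg_le_neg key)) (le_max_right _ _)

/-- **The pipeline S1 + (local certificate) + S3 + S4 ⇒ `Concl`.** From the device's `(t, c)` choose the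
patch size `n₀` with `t n₀ < γ/2`; from `a → 0` choose `β₃` with `a β ≤ K` beyond it, so that the nominal
cell `b = ⌈K/a β⌉` satisfies `b · a(β) ≤ 2K`; the local inequality on the torus `(2S+1)⁴`,
`S ≥ S₁ β := (4n₀+8)⌈K/a β⌉`, is transcribed (S3) into the global one with constant `c(γ − t n₀) > 0`,
and S4 turns it into clustering at rate `ρ n/b ≥ (ρ/2K) a(β) n`. -/
theorem concl_of_localPoincare (hK : KnabeAmplification) (hT : SamplerTranscription)
    (hC : GapToClustering) (r : LatticeRep G) {a : ℝ → ℝ} (hpos : ∀ β, 0 < a β)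
    (hlim : Tendsto a atTop (𝓝 0)) {K γ : ℝ} (hKpos : 0 < K) (hγ : 0 < γ)
    (hloc : ∀ n₀ : ℕ, 1 ≤ n₀ → ∃ β₂ : ℝ, ∀ β : ℝ, β₂ ≤ β → ∀ (N : ℕ) [NeZero N],
      (4 * n₀ + 8) * ⌈K / a β⌉₊ ≤ N → LocalPoincare r β N ⌈K / a β⌉₊ n₀ γ) :
    Concl r a := by
  obtain ⟨t, c, hc, ht, hKW⟩ := hK
  -- patch size from the threshold `t → 0`
  have hev : ∀ᶠ n in atTop, t n < γ / 2 := ht (Iio_mem_nhds (half_pos hγ))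
  obtain ⟨n₀, hn₀, htn₀⟩ := ((eventually_ge_atTop 1).and hev).exists
  have htn₀' : t n₀ < γ := by linarith
  obtain ⟨β₂, hβ₂⟩ := hloc n₀ hn₀
  have hgl : 0 < c * (γ - t n₀) := mul_pos hc (by linarith)
  obtain ⟨ρ, hρ, hAB⟩ := hC G r (c * (γ - t n₀)) hgl
  -- `a β ≤ K` eventually (this is where `Tendsto a atTop (𝓝 0)` is load-bearing, Disproof §4)
  have hevK : ∀ᶠ β in atTop, a β < K := hlim (Iio_mem_nhds hKpos)
  obtain ⟨β₃, hβ₃⟩ := eventually_atTop.1 hevK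
  refine ⟨ρ / (2 * K), max β₂ β₃, fun β => (4 * n₀ + 8) * ⌈K / a β⌉₊, by positivity, fun A B => ?_⟩
  obtain ⟨C, hCAB⟩ := hAB A B
  refine ⟨max C 0, fun β hβ S n hS hn => ?_⟩
  have hβ2 : β₂ ≤ β := (le_max_left _ _).trans hβ
  have haK : a β < K := hβ₃ β ((le_max_right _ _).trans hβ)
  have hKa : 0 < K / a β := div_pos hKpos (hpos β)
  have hb1 : 1 ≤ ⌈K / a β⌉₊ := Nat.one_le_iff_ne_zero.2 (Nat.ceil_pos.2 hKa).ne'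
  have hN : (4 * n₀ + 8) * ⌈K / a β⌉₊ ≤ 2 * S + 1 := hS.trans (by omega)
  have hLP : LocalPoincare r β (2 * S + 1) ⌈K / a β⌉₊ n₀ γ := hβ₂ β hβ2 (2 * S + 1) hN
  have hGP : GlobalPoincare r β (2 * S + 1) ⌈K / a β⌉₊ (c * (γ - t n₀)) :=
    hT t c hKW hc G r β (2 * S + 1) ⌈K / a β⌉₊ n₀ γ hn₀ hb1 hN hγ htn₀' hLP
  have hcorr := hCAB β ⌈K / a β⌉₊ S n hb1 hn hGP
  refine hcorr.trans ?_
  -- compare the exponents: `ρ/(2K) · a β · n ≤ ρ · n / ⌈K/a β⌉` because `⌈K/a β⌉ · a β ≤ 2K`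
  have hbR : ((⌈K / a β⌉₊ : ℕ) : ℝ) < K / a β + 1 := Nat.ceil_lt_add_one hKa.le
  have hba : ((⌈K / a β⌉₊ : ℕ) : ℝ) * a β ≤ 2 * K := by
    have h1 : ((⌈K / a β⌉₊ : ℕ) : ℝ) * a β < (K / a β + 1) * a β := mul_lt_mul_of_pos_right hbR (hpos β)
    have h2 : (K / a β + 1) * a β = K + a β := by
      rw [add_mul, one_mul, div_mul_cancel₀ K (hpos β).ne']
    linarith
  have hbpos : (0 : ℝ) < ((⌈K / a β⌉₊ : ℕ) : ℝ) := by exact_mod_cast hb1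
  have key : ρ / (2 * K) * a β * n ≤ ρ * n / (⌈K / a β⌉₊ : ℕ) := by
    rw [le_div_iff₀ hbpos]
    have e : ρ / (2 * K) * a β * n * ((⌈K / a β⌉₊ : ℕ) : ℝ) =
        ρ * n * ((((⌈K / a β⌉₊ : ℕ) : ℝ)) * a β) / (2 * K) := by ring
    rw [e, div_le_iff₀ (by positivity : (0 : ℝ) < 2 * K)]
    exact mul_le_mul_of_nonneg_left hba (by positivity)
  calc C * Real.exp (-(ρ * n / (⌈K / a β⌉₊ : ℕ))) ≤ max C 0 * Real.exp (-(ρ * n / (⌈K / a β⌉₊ : ℕ))) :=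
        mul_le_mul_of_nonneg_right (le_max_left _ _) (Real.exp_pos _).le
    _ ≤ max C 0 * Real.exp (-(ρ / (2 * K) * a β * n)) :=
        mul_le_mul_of_nonneg_left (Real.exp_le_exp.2 (neg_le_neg key)) (le_max_right _ _)

end Composition

/-- **Final assembly from an S0-shaped witness.** Given, for the ruler `a`, a continuous dominating
ruler `a'` with the package (the shape S0 delivers, and the identity delivers for continuous `a`): S2 at
`a'` gives the local certificate, `concl_of_localPoincare` (S1, S3, S4) clusters in the units of `a'`,
and `concl_of_dominated` returns to the units of `a`. -/
theorem concl_of_reduction (h1 : KnabeAmplification) (h2 : BlockSamplerCertificate)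
    (h3 : SamplerTranscription) (h4 : GapToClustering)
    {G : Type} [Group G] [TopologicalSpace G] [IsTopologicalGroup G] [CompactSpace G]
    (hG : IsCompactSimpleLieGroup G) :
    letI : MeasurableSpace G := borel G
    haveI : BorelSpace G := ⟨rfl⟩
    ∀ (r : LatticeRep G) (a : ℝ → ℝ),
      (∃ (a' : ℝ → ℝ) (K₀ : ℝ), Continuous a' ∧ Package r a' ∧ 0 < K₀ ∧ ∀ᶠ β in atTop, a β ≤ K₀ * a' β) →
        Concl r a := by
  letI : MeasurableSpace G := borel G
  haveI : BorelSpace G := ⟨rfl⟩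
  intro r a hred
  obtain ⟨a', K₀, ha', hP', hK₀, hdom⟩ := hred
  obtain ⟨K, γ, hK, hγ, hloc⟩ := h2 G hG r a' ha' hP'
  obtain ⟨Γ, β₀, ℓ₀, c, C, -, -, hpos, hlim, -, -⟩ := hP'
  exact concl_of_dominated r (concl_of_localPoincare h1 h3 h4 r hpos hlim hK hγ hloc) hK₀ hdom

/-- **The repaired crux C′** (verbatim `Disproof.CruxRepaired`): the crux restricted to CONTINUOUS unit
maps. -/
def CruxRepaired : Prop :=
  ∀ (G : Type) [Group G] [TopologicalSpace G] [IsTopologicalGroup G] [CompactSpace G],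
    IsCompactSimpleLieGroup G →
      letI : MeasurableSpace G := borel G
      haveI : BorelSpace G := ⟨rfl⟩
      ∀ (r : LatticeRep G) (a : ℝ → ℝ), Continuous a → Package r a → Concl r a

/-- **S1–S4 prove the repaired crux outright** (S0 replaced by the identity
`rulerReduction_of_continuous`): the line is a line for C′, as every card and the triage panel say; the
typed crux needs S0 on top. -/
theorem cruxRepaired_of_stubs (h1 : KnabeAmplification) (h2 : BlockSamplerCertificate)
    (h3 : SamplerTranscription) (h4 : GapToClustering) : CruxRepaired := by
  intro G _ _ _ _ hG
  letI : MeasurableSpace G := borel G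
  haveI : BorelSpace G := ⟨rfl⟩
  intro r a ha hP
  exact concl_of_reduction h1 h2 h3 h4 hG r a (rulerReduction_of_continuous r ha hP)

/-- **The reduction statement**: the five stub statements imply the crux (by name). Wrapped in a `def`
so that the only theorem of this file whose stated conclusion is the crux decl is the hypothesis-free
`LatticeGapInUVUnits_of` below. -/
def StubsImplyCrux : Prop :=
  RulerReduction → KnabeAmplification → BlockSamplerCertificate → SamplerTranscription →
    GapToClustering → LatticeGapInUVUnits

/-- **The composition (kernel-checked, no `sorry`).** S0 hands a continuous dominating ruler `a'` with the
package; `concl_of_reduction` does the rest. -/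
theorem stubsImplyCrux : StubsImplyCrux := by
  intro h0 h1 h2 h3 h4
  rw [crux_iff]
  intro G _ _ _ _ hG
  letI : MeasurableSpace G := borel G
  haveI : BorelSpace G := ⟨rfl⟩
  intro r a hP
  exact concl_of_reduction h1 h2 h3 h4 hG r a (h0 G hG r a hP)

/-- **The skeleton: the crux BY NAME from the five registered stubs** (its only `sorry`s are the stubs';
the composition `stubsImplyCrux` is sorry-free). -/
theorem LatticeGapInUVUnits_of : LatticeGapInUVUnits :=
  stubsImplyCrux stub_rulerReduction stub_knabeAmplification stub_blockSamplerCertificate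
    stub_samplerTranscription stub_gapToClustering

/-! ## §4 Checks against the negative side (Disproof §1/§3/§7; landed `Theorems/LatticeGapInUVUnits/Negative/*`) -/

section NegativeChecks

variable {G : Type} [Group G] [TopologicalSpace G] [IsTopologicalGroup G] [CompactSpace G]
  [MeasurableSpace G] [BorelSpace G]

/-- With rate constant `0` the conclusion shape holds outright for EVERY ruler (Disproof §1
`conclRate_zero`, via the tree's a-priori bound `abs_latticeConnectedCorr_le`): all content of `Concl`
sits in `0 < c₁`, which the pipeline produces as `ρ/(2K)` from S4's `ρ > 0` and S2's `K > 0`; and the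
constant is PER PAIR (`∀ A B, ∃ C`), the uniform-`C` shape being refuted for compact simple `G` by the
landed `Negative.not_uniform_constant_clustering_of_simple`. -/
example (r : LatticeRep G) (a : ℝ → ℝ) (A B : YMSpecies G) :
    ∃ C : ℝ, ∀ (β : ℝ) (S n : ℕ),
      |latticeConnectedCorr r.ρ β (2 * S + 1) A.F B.F n| ≤ C * Real.exp (-(0 * a β * n)) := by
  obtain ⟨CA, hCA⟩ := A.bounded
  obtain ⟨CB, hCB⟩ := B.bounded
  refine ⟨2 * (CA * CB), fun β S n => ?_⟩
  simpa using Summit.QuantumFields.YangMills.Theorems.HypercubicLimit.Negative.abs_latticeConnectedCorr_le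
    r β (2 * S + 1) hCA hCB n

/-- For a trivial (subsingleton) gauge group every Wilson expectation is evaluation at the trivial
configuration (Disproof §3; landed as `Negative.wilsonExpectation_eq_apply_one_of_subsingleton`). -/
theorem wilsonExpectation_eq_apply_one_of_subsingleton [Subsingleton G] (r : LatticeRep G) (β : ℝ)
    (L : ℕ) [NeZero L] (F : GaugeConfig 4 L G → ℝ) :
    wilsonExpectation (d := 4) (L := L) r.ρ β F = F 1 := by
  haveI := isProbabilityMeasure_wilsonMeasure (d := 4) (L := L) r.ρ r.continuous β
  have hF : F = fun _ => F 1 := funext fun U => congrArg F (Subsingleton.elim _ _)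
  rw [hF]
  simp [wilsonExpectation]

/-- **No junk regime for the pipeline**: for a subsingleton gauge group the PACKAGE (hypothesis of S0, S2
and of the crux) is unsatisfiable — the femto lower bound `0 < c Γ(a β) ≤ Cov = 0` fails in the box
`L = 8` (Disproof §3 `not_package_of_subsingleton`; landed `Negative.not_femto_lower_bound_of_subsingleton`).
So no stub is ever instantiated where the gauge group is trivial. -/
theorem not_package_of_subsingleton [Subsingleton G] (r : LatticeRep G) (a : ℝ → ℝ) : ¬ Package r a := by
  rintro ⟨Γ, β₀, ℓ₀, c, C, hℓ, hc, hpos, hlim, hΓ, hbox⟩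
  have hev : ∀ᶠ β in atTop, a β < ℓ₀ / 8 := hlim (Iio_mem_nhds (by positivity))
  obtain ⟨β, hβ₀, hβ⟩ := ((eventually_ge_atTop β₀).and hev).exists
  haveI : NeZero (8 : ℕ) := ⟨by norm_num⟩
  have hB : BoxBounds r a Γ c C 8 β := hbox 8 β hβ₀ (by push_cast; linarith)
  obtain ⟨hax, -⟩ := hB
  have h1 := (hax 1 le_rfl (by norm_num)).1
  simp only [Nat.cast_one, one_mul, one_pow, wilsonExpectation_eq_apply_one_of_subsingleton, sub_self,
    mul_zero] at h1
  have hΓ1 := (hΓ (a β) (hpos β) (by linarith)).1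
  nlinarith

end NegativeChecks

end Summit.QuantumFields.YangMills.Cruxes.LatticeGapInUVUnits.KnabeBlockSampler

end
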